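import Summits.CriticalPhenomena.PercolationContinuityZ3.Theorems.Transplant.PlanarSkeletonFrmQuasiDefs
import Summits.CriticalPhenomena.PercolationContinuityZ3.Theorems.Transplant.SkelFrmQuasiBParamsBridge0
import Summits.CriticalPhenomena.PercolationContinuityZ3.Theorems.Transplant.SkelFrmBParamsBridge0
import Summits.CriticalPhenomena.PercolationContinuityZ3.Theorems.Transplant.SkelFrmQuasiBChoiceLinks
import Summits.CriticalPhenomena.PercolationContinuityZ3.Theorems.Transplant.SkelFrmBChoiceLinks
import Summits.CriticalPhenomena.PercolationContinuityZ3.Theorems.Transplant.SkelFrmFrom1Normalise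
import Summits.CriticalPhenomena.PercolationContinuityZ3.Theorems.Transplant.SkelFrm1Normalise
import Summits.CriticalPhenomena.PercolationContinuityZ3.Theorems.Transplant.SkelFrmQuasi1ChoiceDefs
import Summits.CriticalPhenomena.PercolationContinuityZ3.Theorems.Transplant.SkelFrmQuasi1SlotTypes
import Summits.CriticalPhenomena.PercolationContinuityZ3.Theorems.Transplant.SkelFrmQuasiBChoiceAtQ
import Summits.CriticalPhenomena.PercolationContinuityZ3.Theorems.Transplant.SkelFrmQuasiBChoiceDefs
import Summits.CriticalPhenomena.PercolationContinuityZ3.Theorems.Transplant.SkelFrmQuasiBChoiceDefs3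
import Summits.CriticalPhenomena.PercolationContinuityZ3.Theorems.Transplant.SkelFrmQuasiBChoiceNums
import Summits.CriticalPhenomena.PercolationContinuityZ3.Theorems.Transplant.SkelFrmQuasiBParamsLF
import Summits.CriticalPhenomena.PercolationContinuityZ3.Theorems.Transplant.SkelFrmQuasiBParamsLO
import HarnessLib
import Summits.CriticalPhenomena.PercolationContinuityZ3.Theorems.Transplant.SkelFrmBChoiceBridge0
/-!
# GEN-Q PORT (WAVE-Q table v0.8 section 2, row G118, U-level L15; captain R-6/R-7 2026-08-27: carrier token swap `PlanarSkeletonFrmFrom ↦ PlanarSkeletonFrmQuasi`)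
# of the tree module «Transplant/SkelFrmFromBChoiceBridge0» (sha256 e3f4b6099c1e2646…) onto the quasi-step carrier `PlanarSkeletonFrmQuasi` (p507026): «SkelFrmQuasiBChoiceBridge0»

ORIGINAL TITLE: N2 (frames-only node `SamePDropOfSkeletonFrm₁`, OPEN), (R) value layer — part ChoiceBridge0: **THE ROOT BRIDGE AT `AtQNQ`** —

builds on p205010 (kernel theorem, internal audit signed; external expert review pending) — nothing in this file uses p205010; NOTHING is claimed about any open node
((N3-b), the end state).  Lane `prim-bschramm`, seat `prim-bschramm-gen-3` (gen 0; GEN-Q port pen #3, tool of record port_genq.py of captain gen-1 g5).  Helper file (`--supports stmt-CriticalPhenomena-4575 --as helper`).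
PORT RULES (U-wave r1–r4 re-used, GEN-Q hunk classes of p3-g29 #6136): declaration order, names and proof texts are those of «SkelFrmFromBChoiceBridge0», byte-identical except
(i) the carrier token `PlanarSkeletonFrmFrom ↦ PlanarSkeletonFrmQuasi` in binders, `namespace`/`end` lines and qualified names (module names `SkelFrmFrom… ↦ SkelFrmQuasi…`
in imports of already-ported rows); (ii) `Φ.step ↦ Φ.qstep` with the called Steps lemma replaced by its `…Q`/`_q` twin and the cost `Φ.M` threaded (none in this file unless
listed below); (iii) `Φ.cyl_connected ↦ Φ.cyl_reach` readers (none unless listed); (iv) graph-ball radii / window floors ×`Φ.M` (none unless listed).  Carrier-free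
residents stay imported/exported from the original «SkelFrmBChoiceBridge0» exactly as in the FrmFrom port.  Docstrings and citations are the original's.
-/

noncomputable section

open scoped Classical

namespace Summit.CriticalPhenomena.PercolationContinuityZ3.Theorems.Transplant

open MeasureTheory Literature.Probability.Percolation Literature.Probability.LatticeModels SimpleGraph KNCells KNLevels
open Literature.Barriers.CriticalPhenomena (graphBall)

namespace PlanarSkeletonFrmQuasi

export PlanarSkeletonFrmFrom.NegB (eqNumB_of_eqGeom hB)  -- T3-auto: resident alias(es) replicated from the FrmFrom namespace
export PlanarSkeletonFrmFrom.Neg (oL φL)  -- T3-auto: resident alias(es) replicated from the FrmFrom namespace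

open SkelConc (Consts)
open Skelφ (oriφ trφ rootFrame pgSideHalfW pgramPrismFin)
open Skelφ.StepI (DataN DataNS OutNS)
open ChainPlanar (BridgePrm BridgeOK)

namespace NegB

open Neg

section Bridge0

variable {κ : Consts} {V : Type} [DecidableEq V] [Countable V] {G : SimpleGraph V} [G.LocallyFinite] {Φ : PlanarSkeletonFrmQuasi G} {t : V} {p : unitInterval}
  {hC : Φ.CylSubcritical p} {gv fv : Neg.FSlot} {Pv : PSlot} {Sv : SSlot} {cv : CSlot} {bv : BSlot} {O : OutNS V} {q : unitInterval}

/-! ## §1 Orientation, served sign, clause -/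

/-- **THE ROOT BRIDGE READS THE LONG MAP**: `O.ori t MB0 nB0 = o_L` (both pairs are selected; `FactsNS.sel_ori`). [this work] -/
theorem ori_bridge0_eq_oL {κ : Consts} {V : Type} [DecidableEq V] [Countable V] {G : SimpleGraph V} [G.LocallyFinite] {Φ : PlanarSkeletonFrmQuasi G} {t : V} {p : unitInterval} {hC : Φ.CylSubcritical p} {gv : Neg.FSlot} {fv : Neg.FSlot} {Pv : PSlot} {Sv : SSlot} {cv : CSlot} {bv : BSlot} {O : OutNS V} {q : unitInterval} (hAt : (choiceAtQ3 κ Φ t p Pv gv fv Sv cv bv hC).AtQNQ O q) (mk : ℕ) :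
    O.ori t (KS.MB0 κ Φ t p O.merged mk) (KS.nB0 κ Φ t p O.merged mk) = oL κ Φ t p O.D O.DT.toDataN O.ori (gOf κ Φ t p O gv) (fOf κ Φ t p O fv) :=
  Skelφ.StepI.OutNS.FactsNS.sel_ori hAt.1 _ _ _ _

/-- **Hence the bridge pair's oriented map IS `φL`.** [folklore] -/
theorem oriφ_bridge0_eq_φL {κ : Consts} {V : Type} [DecidableEq V] [Countable V] {G : SimpleGraph V} [G.LocallyFinite] {Φ : PlanarSkeletonFrmQuasi G} {t : V} {p : unitInterval} {hC : Φ.CylSubcritical p} {gv : Neg.FSlot} {fv : Neg.FSlot} {Pv : PSlot} {Sv : SSlot} {cv : CSlot} {bv : BSlot} {O : OutNS V} {q : unitInterval} (hAt : (choiceAtQ3 κ Φ t p Pv gv fv Sv cv bv hC).AtQNQ O q) (mk : ℕ) :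
    oriφ Φ.φ (O.ori t (KS.MB0 κ Φ t p O.merged mk) (KS.nB0 κ Φ t p O.merged mk)) = φL κ Φ t p O.D O.DT.toDataN O.ori (gOf κ Φ t p O gv) (fOf κ Φ t p O fv) := by
  rw [ori_bridge0_eq_oL hAt mk]; rfl

/-- **The served near sign at the root bridge pair is `1`** (both families). [folklore] -/
theorem sgQ_bridge0_eq_one {κ : Consts} {V : Type} [DecidableEq V] [Countable V] {G : SimpleGraph V} [G.LocallyFinite] {Φ : PlanarSkeletonFrmQuasi G} {t : V} {p : unitInterval} {hC : Φ.CylSubcritical p} {gv : Neg.FSlot} {fv : Neg.FSlot} {Pv : PSlot} {Sv : SSlot} {cv : CSlot} {bv : BSlot} {O : OutNS V} {q : unitInterval} (hAt : (choiceAtQ3 κ Φ t p Pv gv fv Sv cv bv hC).AtQNQ O q) (mk : ℕ) (fam : Fin 2) :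
    Skelφ.StepI.sgQ O.qd O.qdT O.ori t (KS.MB0 κ Φ t p O.merged mk) (KS.nB0 κ Φ t p O.merged mk) fam = 1 :=
  sgQ_sel_eq_one hAt _ _ fam

/-- **THE ROOT BRIDGE CLAUSE at `AtQNQ`**: the merged record's geometric clause at `(MB0, nB0)` for the map `φL`, and `|hB0| ≤ 10·nB0`. [this work] -/
theorem clauseB0_of_atQ3 {κ : Consts} {V : Type} [DecidableEq V] [Countable V] {G : SimpleGraph V} [G.LocallyFinite] {Φ : PlanarSkeletonFrmQuasi G} {t : V} {p : unitInterval} {hC : Φ.CylSubcritical p} {gv : Neg.FSlot} {fv : Neg.FSlot} {Pv : PSlot} {Sv : SSlot} {cv : CSlot} {bv : BSlot} {O : OutNS V} {q : unitInterval} (hAt : (choiceAtQ3 κ Φ t p Pv gv fv Sv cv bv hC).AtQNQ O q) (mk : ℕ) :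
    O.merged.EqGeom G (φL κ Φ t p O.D O.DT.toDataN O.ori (gOf κ Φ t p O gv) (fOf κ Φ t p O fv)) t (KS.MB0 κ Φ t p O.merged mk) (KS.nB0 κ Φ t p O.merged mk) ∧
      (KS.hB0 κ Φ t p O.merged mk).natAbs ≤ 10 * KS.nB0 κ Φ t p O.merged mk := by
  have h := clauseP_of_atQ hAt (KS.bridge0_adm κ Φ t p O.merged mk).1 (KS.bridge0_adm κ Φ t p O.merged mk).2
  rw [oriφ_bridge0_eq_φL hAt mk] at h
  exact h

/-- The root bridge pair's numeric facts (ℤ shapes): `MB0 < nB0`, `MB0 < ℓB0`, `|vB0| ≤ nB0`, the layer inequality. [folklore] -/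
theorem eqNumB0_of_atQ3 {κ : Consts} {V : Type} [DecidableEq V] [Countable V] {G : SimpleGraph V} [G.LocallyFinite] {Φ : PlanarSkeletonFrmQuasi G} {t : V} {p : unitInterval} {hC : Φ.CylSubcritical p} {gv : Neg.FSlot} {fv : Neg.FSlot} {Pv : PSlot} {Sv : SSlot} {cv : CSlot} {bv : BSlot} {O : OutNS V} {q : unitInterval} (hAt : (choiceAtQ3 κ Φ t p Pv gv fv Sv cv bv hC).AtQNQ O q) (mk : ℕ) :
    KS.MB0 κ Φ t p O.merged mk < KS.nB0 κ Φ t p O.merged mk ∧ KS.MB0 κ Φ t p O.merged mk < KS.ℓB0 κ Φ t p O.merged mk ∧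
      |KS.vB0 κ Φ t p O.merged mk| ≤ (KS.nB0 κ Φ t p O.merged mk : ℤ) ∧
      ((KS.MB0 κ Φ t p O.merged mk : ℤ) + 1) * ((KS.nB0 κ Φ t p O.merged mk : ℤ) + |KS.hB0 κ Φ t p O.merged mk|) ≤
        (KS.nB0 κ Φ t p O.merged mk : ℤ) * ((KS.ℓB0 κ Φ t p O.merged mk : ℤ) + 1) :=
  eqNumB_of_eqGeom t O.merged _ _ _ (clauseB0_of_atQ3 hAt mk).1

/-- **`2·b0 + 27 ≤ ℓB0` at `AtQNQ`** (so `3 ≤ ℓB0`, `27 ≤ ℓB0`). [folklore] -/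
theorem ℓB0_ge_of_atQ3 {κ : Consts} {V : Type} [DecidableEq V] [Countable V] {G : SimpleGraph V} [G.LocallyFinite] {Φ : PlanarSkeletonFrmQuasi G} {t : V} {p : unitInterval} {hC : Φ.CylSubcritical p} {gv : Neg.FSlot} {fv : Neg.FSlot} {Pv : PSlot} {Sv : SSlot} {cv : CSlot} {bv : BSlot} {O : OutNS V} {q : unitInterval} (hAt : (choiceAtQ3 κ Φ t p Pv gv fv Sv cv bv hC).AtQNQ O q) (mk : ℕ) :
    2 * KS.b0 κ Φ t p O.merged mk + 27 ≤ KS.ℓB0 κ Φ t p O.merged mk :=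
  KS.ℓB0_ge κ Φ t p O.merged mk _ (clauseB0_of_atQ3 hAt mk).1

/-- **`hB` at `AtQNQ`**: the root bridge frame is admissible. [folklore] -/
theorem B0_ok_of_atQ3 {κ : Consts} {V : Type} [DecidableEq V] [Countable V] {G : SimpleGraph V} [G.LocallyFinite] {Φ : PlanarSkeletonFrmQuasi G} {t : V} {p : unitInterval} {hC : Φ.CylSubcritical p} {gv : Neg.FSlot} {fv : Neg.FSlot} {Pv : PSlot} {Sv : SSlot} {cv : CSlot} {bv : BSlot} {O : OutNS V} {q : unitInterval} (hAt : (choiceAtQ3 κ Φ t p Pv gv fv Sv cv bv hC).AtQNQ O q) (mk : ℕ) :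
    BridgeOK (KS.B0 κ Φ t p O.merged mk (gOf κ Φ t p O gv) (fOf κ Φ t p O fv)) :=
  KS.B0_ok κ Φ t p O.merged mk _ _ (by have := ℓB0_ge_of_atQ3 hAt mk; omega)

-- GEN-Q (R-2, captain 2026-08-27): `PlanarSkeletonFrmFrom.NegB.zone_subset_cyl_φL` is not in the used cone of the node top — not ported.

/-! ## §2 The readings of the bridge sets against `KS.B0` -/

-- GEN-Q (R-2, captain 2026-08-27): `PlanarSkeletonFrmFrom.NegB.bridge0Sets_of_atQ3` is not in the used cone of the node top — not ported.

/-! ## §3 The bridge event -/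

-- GEN-Q (R-2, captain 2026-08-27): `PlanarSkeletonFrmFrom.NegB.hbridge0_of_atQ3` is not in the used cone of the node top — not ported.

-- GEN-Q (R-2, captain 2026-08-27): `PlanarSkeletonFrmFrom.NegB.hbridge0K_of_atQ3` is not in the used cone of the node top — not ported.

-- GEN-Q (R-2, captain 2026-08-27): `PlanarSkeletonFrmFrom.NegB.hbridge0K_of_atQ3_δr` is not in the used cone of the node top — not ported.

-- GEN-Q (R-2, captain 2026-08-27): `PlanarSkeletonFrmFrom.NegB.hbridge0_of_atQ3_δr` is not in the used cone of the node top — not ported.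

end Bridge0

end NegB

end PlanarSkeletonFrmQuasi

end Summit.CriticalPhenomena.PercolationContinuityZ3.Theorems.Transplant

end
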